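import Summits.RiemannHypothesis.RiemannHypothesis.Theorems.WeilFormatCCinfHankelFar
import HarnessLib

/-!
# Format C, design C∞ (E2c, data side): FAR TAILS of the Hankel entries, part 2 — crude majorants and log × trig tails

Continuation of `WeilFormatCCinfHankelFar` (same namespace `CinfHankelR`, same conventions; supporting
stmt-RiemannHypothesis-0098; seat rh-explicit-weil-2):

* `tagC`/`tagCBox`/`lamBox` (+ `mem_…`), `tagT_sq_summable`, `summable_farTerm`, `mem_crudePure`, `mem_crudeLog` — for ANY pair
  `|far| ≤ c_t c_t' · Σ'_k w(B₄+k)(m₀/(B₄+k))^s` with `c = (1, ·, Λ_tot, Λ_tot)`, as a symmetric box (tolerated by the certificate at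
  large `s`, measured by the gen18 kit sweeps j239112/j239135/j239163);
* `logTrigFarList`/`wsum`/`mem_logTrigFarList`, `farSum_12_eq`/`farSum_13_eq`, `mem_far12`/`mem_far13` — the log × trig pairs by the
  one-fold Abel evaluator `logTrigFarScaledBox` (`WeilFormatCCinfLogTrigTails`) summed over the prime list.

Interval bookkeeping over landed evaluators; standard axioms; no RH claim.
-/

-- `Summit.RiemannHypothesis.RiemannHypothesis.…` is the layout-mandated namespace (summit = problem name).
set_option linter.dupNamespace false

open Finset
open scoped Real ArithmeticFunction.vonMangoldt

namespace Summit.RiemannHypothesis.RiemannHypothesis.Theorems.WeilFormatC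

namespace CinfHankelR

open Literature.NumberTheory.LFunctions Literature.NumberTheory.LFunctions.Yoshida1992 Literature.Analysis.SpecialFunctions
open Literature.Analysis.ValidatedNumerics Literature.Analysis.ValidatedNumerics.NumericsMP
open Encl (Consts ConstsValid)
open WinEntry (sumBox mem_sumBox)
open CinfCoeff (pureFarScaledBox mem_pureFarScaledBox logFarScaledBox mem_logFarScaledBox logSqFarScaledBox mem_logSqFarScaledBox
  trigFarScaledBox mem_trigFarScaledBox)

variable {S : ℕ} {a : ℝ} {ks : List PrimeLen} {C : Consts}

/-! ## Crude majorants (any pair; tolerated by the certificate at large `s`) -/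

/-- `|C_m|, |S_m| ≤ Λ := Σ_{n ∈ weilPrimeIndex a} Λ(n)/√n` and `|1| ≤ 1`, `0 ≤ log m`: the absolute tag bounds. -/
theorem abs_tagT_two_le (a : ℝ) (m : ℕ) : |tagT a 2 m| ≤ ∑ n ∈ weilPrimeIndex a, (Λ n : ℝ) / Real.sqrt n := by
  rw [tagT_two, abs_neg]
  refine (Finset.abs_sum_le_sum_abs _ _).trans (Finset.sum_le_sum fun n _ ↦ ?_)
  rw [abs_mul]
  have h0 : 0 ≤ (Λ n : ℝ) / Real.sqrt n := div_nonneg ArithmeticFunction.vonMangoldt_nonneg (Real.sqrt_nonneg _)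
  rw [abs_of_nonneg h0]
  exact mul_le_of_le_one_right h0 (Real.abs_cos_le_one _)

/-- `|S_m| ≤ Λ_tot`. -/
theorem abs_tagT_three_le (a : ℝ) (m : ℕ) : |tagT a 3 m| ≤ ∑ n ∈ weilPrimeIndex a, (Λ n : ℝ) / Real.sqrt n := by
  rw [tagT_three]
  refine (Finset.abs_sum_le_sum_abs _ _).trans (Finset.sum_le_sum fun n _ ↦ ?_)
  rw [abs_mul]
  have h0 : 0 ≤ (Λ n : ℝ) / Real.sqrt n := div_nonneg ArithmeticFunction.vonMangoldt_nonneg (Real.sqrt_nonneg _)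
  rw [abs_of_nonneg h0]
  exact mul_le_of_le_one_right h0 (Real.abs_sin_le_one _)

/-- The absolute bound of a tag: `1` for `t = 0`, `Λ` for `t = 2, 3` (the `log` tag is kept as a weight, not bounded). -/
noncomputable def tagC (a : ℝ) (t : Fin 4) : ℝ := if (t : ℕ) = 0 then 1 else ∑ n ∈ weilPrimeIndex a, (Λ n : ℝ) / Real.sqrt n

/-- `|tagT_t(m)| ≤ tagC_t` for the bounded tags `t ≠ 1`. -/
theorem abs_tagT_le_tagC (a : ℝ) (m : ℕ) {t : Fin 4} (ht : (t : ℕ) ≠ 1) : |tagT a t m| ≤ tagC a t := by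
  fin_cases t
  · simp [tagT_zero, tagC]
  · exact absurd rfl ht
  · simpa [tagC] using abs_tagT_two_le a m
  · simpa [tagC] using abs_tagT_three_le a m

/-- Box of `Λ_tot = Σ_{k ∈ weilPrimeIndex a} Λ(k) k^{-1/2}`: the sum of the weight list of the constants record
(the same box as the remainder-input module's `lamBox`; kept local so that this file does not import it). -/
def lamBox (S : ℕ) (C : Consts) : MI := sumBox S (fun i ↦ C.wts.getD i default) C.wts.length

/-- `lamBox ∋ Σ_{k ∈ weilPrimeIndex a} Λ(k)/√k`. -/
theorem mem_lamBox (hks : PrimeData a ks) (hC : ConstsValid S a ks C) :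
    MI.mem S (∑ k ∈ weilPrimeIndex a, (Λ k : ℝ) / Real.sqrt k) (lamBox S C) := by
  have h1 : ∑ k ∈ weilPrimeIndex a, (Λ k : ℝ) / Real.sqrt k
      = ∑ i ∈ Finset.range ks.length, (ks.getD i default).wt := by
    have h := Encl.sum_weilPrimeIndex_eq_listSum hks (fun _ ↦ (1 : ℝ))
    simp only [mul_one] at h
    rw [h, Encl.list_sum_map_eq_sum_range]
  rw [h1, lamBox, hC.wts_len]
  exact mem_sumBox ks.length fun i hi ↦ hC.wts i hi

/-- **Square-summability of the four tags** beyond any threshold `M ≥ 4`: `Σ_k tagT_t(M+k)²/(M+k)² < ∞`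
(the `hT` input of `mem_entry` and of the far lemmas, stated for `CinfHankelR.tagT`). -/
theorem tagT_sq_summable (a : ℝ) {M : ℕ} (hM : 4 ≤ M) (t : Fin 4) :
    Summable fun k : ℕ ↦ tagT a t (M + k) ^ 2 / ((M + k : ℕ) : ℝ) ^ 2 := by
  fin_cases t
  · simpa [tagT_zero] using cinf_summable_tag_sq_of_abs_le (T := fun _ : ℕ ↦ (1 : ℝ)) (A := 1) (fun _ ↦ by simp) M
  · simpa [tagT_one] using cinf_summable_log_sq hM
  · exact cinf_summable_tag_sq_of_abs_le (T := fun m : ℕ ↦ tagT a 2 m)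
      (A := ∑ n ∈ weilPrimeIndex a, (Λ n : ℝ) / Real.sqrt n) (fun m ↦ abs_tagT_two_le a m) M
  · exact cinf_summable_tag_sq_of_abs_le (T := fun m : ℕ ↦ tagT a 3 m)
      (A := ∑ n ∈ weilPrimeIndex a, (Λ n : ℝ) / Real.sqrt n) (fun m ↦ abs_tagT_three_le a m) M

/-- Box of `tagC`: `1` or `Λ_tot` (`lamBox`). -/
def tagCBox (S : ℕ) (C : Consts) (t : ℕ) : MI := if t = 0 then WinConst.ratBox S 1 else lamBox S C

/-- `tagCBox ∋ tagC`. -/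
theorem mem_tagCBox (hks : PrimeData a ks) (hC : ConstsValid S a ks C) (t : Fin 4) :
    MI.mem S (tagC a t) (tagCBox S C t) := by
  unfold tagC tagCBox
  by_cases h : (t : ℕ) = 0
  · rw [if_pos h, if_pos h]; simpa using WinConst.mem_ratBox S 1
  · rw [if_neg h, if_neg h]; exact mem_lamBox hks hC

/-- A crude bound of a tsum from termwise majorisation by a nonnegative summable sequence. -/
private theorem abs_tsum_le_tsum_of_abs_le {f g : ℕ → ℝ} (hf : Summable f) (hg : Summable g) (hfg : ∀ k, |f k| ≤ g k) :
    |∑' k, f k| ≤ ∑' k, g k := by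
  refine CinfCoeff.abs_tsum_le_of_abs_sum_range_le hf fun n ↦ ?_
  refine (Finset.abs_sum_le_sum_abs _ _).trans ((Finset.sum_le_sum fun k _ ↦ hfg k).trans ?_)
  exact hg.sum_le_tsum _ fun k _ ↦ (abs_nonneg _).trans (hfg k)

/-- Summability of the far terms of any pair (from the square-summability of the tags at `B₄ ≥ 1`). -/
theorem summable_farTerm {B₄ : ℕ} (hB₄ : 1 ≤ B₄)
    (hT : ∀ t : Fin 4, Summable fun k : ℕ ↦ tagT a t (B₄ + k) ^ 2 / ((B₄ + k : ℕ) : ℝ) ^ 2)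
    (m₀ : ℕ) (t t' : Fin 4) {s : ℕ} (hs : 2 ≤ s) :
    Summable fun k : ℕ ↦ tagT a t (B₄ + k) * tagT a t' (B₄ + k) * ((m₀ : ℝ) / ((B₄ + k : ℕ) : ℝ)) ^ s := by
  have h := CinfCoeff.summable_hankel_term hB₄ (hT t) (hT t') hs
  refine (h.mul_left (((m₀ : ℝ) / (B₄ : ℝ)) ^ s)).congr fun k ↦ ?_
  have hB : (B₄ : ℝ) ≠ 0 := by exact_mod_cast (show B₄ ≠ 0 by omega)
  have hBk : ((B₄ + k : ℕ) : ℝ) ≠ 0 := by exact_mod_cast (show B₄ + k ≠ 0 by omega)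
  rw [show ((m₀ : ℝ) / ((B₄ + k : ℕ) : ℝ)) = ((m₀ : ℝ) / (B₄ : ℝ)) * ((B₄ : ℝ) / ((B₄ + k : ℕ) : ℝ)) by field_simp, mul_pow]
  ring

/-- ★ **Crude box, trig × pure/trig** (`t, t' ∈ {0,2,3}`): `|farSum| ≤ c_t c_t' Σ'_k (m₀/(B₄+k))^s`. -/
theorem mem_crudePure (hS : 0 < S) (hks : PrimeData a ks) (hC : ConstsValid S a ks C) {m₀ B₄ s : ℕ} (hB₄ : 1 ≤ B₄)
    (hs : 2 ≤ s) (hT : ∀ t : Fin 4, Summable fun k : ℕ ↦ tagT a t (B₄ + k) ^ 2 / ((B₄ + k : ℕ) : ℝ) ^ 2)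
    (J : ℕ) {ν : ℕ} (hν : ν ≠ 0) {t t' : Fin 4} (ht : (t : ℕ) ≠ 1) (ht' : (t' : ℕ) ≠ 1) :
    MI.mem S (farSum a m₀ B₄ t t' s)
      (symBox (((tagCBox S C t).mul S (tagCBox S C t')).mul S (pureFarScaledBox S m₀ B₄ s J ν))) := by
  have hP := mem_pureFarScaledBox (S := S) (m₀ := m₀) (by omega : 0 < B₄) hs J hν
  have hsumP : Summable fun k : ℕ ↦ ((m₀ : ℝ) / ((B₄ + k : ℕ) : ℝ)) ^ s :=
    (summable_cos_far 0 hs m₀ B₄).congr fun k ↦ by simp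
  have hc0 : 0 ≤ tagC a t := (abs_nonneg _).trans (abs_tagT_le_tagC a B₄ ht)
  have hc0' : 0 ≤ tagC a t' := (abs_nonneg _).trans (abs_tagT_le_tagC a B₄ ht')
  refine mem_symBox_of_abs_le ?_ (MI.mem_mul hS (MI.mem_mul hS (mem_tagCBox hks hC t) (mem_tagCBox hks hC t')) hP)
  unfold farSum
  rw [← tsum_mul_left]
  refine abs_tsum_le_tsum_of_abs_le (summable_farTerm hB₄ hT m₀ t t' hs) (hsumP.mul_left _) fun k ↦ ?_
  have hr : 0 ≤ ((m₀ : ℝ) / ((B₄ + k : ℕ) : ℝ)) ^ s := by positivity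
  rw [abs_mul, abs_mul, abs_of_nonneg hr]
  exact mul_le_mul_of_nonneg_right (mul_le_mul (abs_tagT_le_tagC a _ ht) (abs_tagT_le_tagC a _ ht') (abs_nonneg _) hc0) hr

/-- ★ **Crude box, log × trig** (`t' ∈ {2,3}`): `|farSum 1 t'| ≤ c_t' Σ'_k log(B₄+k)(m₀/(B₄+k))^s` (and symmetric). -/
theorem mem_crudeLog (hS : 0 < S) (hks : PrimeData a ks) (hC : ConstsValid S a ks C) {K m₀ B₄ s : ℕ} (hB₄ : 3 ≤ B₄)
    (hs : 2 ≤ s) (hT : ∀ t : Fin 4, Summable fun k : ℕ ↦ tagT a t (B₄ + k) ^ 2 / ((B₄ + k : ℕ) : ℝ) ^ 2)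
    {B : MI} (hB : logFarScaledBox S K m₀ B₄ s = some B) {t' : Fin 4} (ht' : (t' : ℕ) ≠ 1) :
    MI.mem S (farSum a m₀ B₄ 1 t' s) (symBox ((tagCBox S C t').mul S B)) := by
  have hL := mem_logFarScaledBox hS hB₄ hs hB
  have hc0' : 0 ≤ tagC a t' := (abs_nonneg _).trans (abs_tagT_le_tagC a B₄ ht')
  -- summability of the log far terms: it is the `(0,1)` far sum's terms
  have hsumL : Summable fun k : ℕ ↦ Real.log ((B₄ + k : ℕ) : ℝ) * ((m₀ : ℝ) / ((B₄ + k : ℕ) : ℝ)) ^ s :=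
    (summable_farTerm (by omega) hT m₀ 0 1 hs).congr fun k ↦ by rw [tagT_zero, tagT_one, one_mul]
  refine mem_symBox_of_abs_le ?_ (MI.mem_mul hS (mem_tagCBox hks hC t') hL)
  unfold farSum
  rw [← tsum_mul_left]
  refine abs_tsum_le_tsum_of_abs_le (summable_farTerm (by omega) hT m₀ 1 t' hs) (hsumL.mul_left _) fun k ↦ ?_
  have hr : 0 ≤ ((m₀ : ℝ) / ((B₄ + k : ℕ) : ℝ)) ^ s := by positivity
  have hlog : 0 ≤ Real.log ((B₄ + k : ℕ) : ℝ) := Real.log_nonneg (by exact_mod_cast (show 1 ≤ B₄ + k by omega))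
  rw [tagT_one, abs_mul, abs_mul, abs_of_nonneg hr, abs_of_nonneg hlog]
  calc Real.log ((B₄ + k : ℕ) : ℝ) * |tagT a t' (B₄ + k)| * ((m₀ : ℝ) / ((B₄ + k : ℕ) : ℝ)) ^ s
      ≤ Real.log ((B₄ + k : ℕ) : ℝ) * tagC a t' * ((m₀ : ℝ) / ((B₄ + k : ℕ) : ℝ)) ^ s :=
        mul_le_mul_of_nonneg_right (mul_le_mul_of_nonneg_left (abs_tagT_le_tagC a _ ht') hlog) hr
    _ = tagC a t' * (Real.log ((B₄ + k : ℕ) : ℝ) * ((m₀ : ℝ) / ((B₄ + k : ℕ) : ℝ)) ^ s) := by ring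

/-! ## Log × trig by one-fold Abel -/

/-- The list of per-frequency `log`-weighted trig far boxes (claimed lower bounds `σ_i ≤ |sin(φ_i/2)|`). -/
def logTrigFarList (S Ke ke Kl : ℕ) (C : Consts) (σs : List ℚ) (nks m₀ B₄ s : ℕ) : Option (List MI) :=
  Encl.omap (fun i ↦ CinfCoeff.logTrigFarScaledBox S Ke ke Kl C.P (phaseBox S C i) (σs.getD i 0) m₀ B₄ s 1) (List.range nks)

/-- Weighted sum of a box list: `Σ_{i<n} W_i · L_i`. -/
def wsum (S : ℕ) (W L : List MI) (n : ℕ) : MI := sumBox S (fun i ↦ (W.getD i default).mul S (L.getD i default)) n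

/-- soundness of `logTrigFarList`: entry `i` encloses the one-fold-Abel log×trig far tail at the phase `φ_i`. -/
theorem mem_logTrigFarList (hS : 0 < S) (hC : ConstsValid S a ks C) {Ke ke Kl m₀ B₄ s : ℕ} {σs : List ℚ} (hB₄ : 4 ≤ B₄)
    (hs : 2 ≤ s) {L : List MI} (hL : logTrigFarList S Ke ke Kl C σs ks.length m₀ B₄ s = some L) {i : ℕ} (hi : i < ks.length) :
    MI.mem S (∑' k : ℕ, Real.log ((B₄ + k : ℕ) : ℝ) ^ 1 * Real.cos ((B₄ + k : ℕ) * (π * (ks.getD i default).len / a))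
        * ((m₀ : ℝ) / ((B₄ + k : ℕ) : ℝ)) ^ s) (L.getD i default) ∧
      MI.mem S (∑' k : ℕ, Real.log ((B₄ + k : ℕ) : ℝ) ^ 1 * Real.sin ((B₄ + k : ℕ) * (π * (ks.getD i default).len / a))
        * ((m₀ : ℝ) / ((B₄ + k : ℕ) : ℝ)) ^ s) (L.getD i default) := by
  obtain ⟨_, hiL⟩ := Encl.omap_spec hL
  have hi' : i < (List.range ks.length).length := by simpa using hi
  have e := hiL i hi'
  rw [List.getD_eq_getElem?_getD, List.getElem?_range hi, Option.getD_some] at e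
  exact CinfCoeff.mem_logTrigFarScaledBox hS hC.pi (mem_phaseBox hS hC hi) hB₄ hs (Or.inl rfl) e

/-- summability of `log(B₄+k)·cos((B₄+k)φ)(m₀/(B₄+k))^s` for `2 ≤ s`, `4 ≤ B₄`. -/
private theorem summable_log_cos_far (φ : ℝ) {s : ℕ} (hs : 2 ≤ s) (m₀ : ℕ) {B₄ : ℕ} (hB₄ : 4 ≤ B₄)
    (hT : ∀ t : Fin 4, Summable fun k : ℕ ↦ tagT a t (B₄ + k) ^ 2 / ((B₄ + k : ℕ) : ℝ) ^ 2) (trig : ℝ → ℝ)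
    (htrig : ∀ x, |trig x| ≤ 1) :
    Summable fun k : ℕ ↦ Real.log ((B₄ + k : ℕ) : ℝ) ^ 1 * trig ((B₄ + k : ℕ) * φ) * ((m₀ : ℝ) / ((B₄ + k : ℕ) : ℝ)) ^ s := by
  have hsumL : Summable fun k : ℕ ↦ Real.log ((B₄ + k : ℕ) : ℝ) * ((m₀ : ℝ) / ((B₄ + k : ℕ) : ℝ)) ^ s :=
    (summable_farTerm (by omega) hT m₀ 0 1 hs).congr fun k ↦ by rw [tagT_zero, tagT_one, one_mul]
  refine Summable.of_norm_bounded hsumL.abs fun k ↦ ?_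
  rw [Real.norm_eq_abs, pow_one, abs_mul, abs_mul, abs_mul]
  have hlog : 0 ≤ |Real.log ((B₄ + k : ℕ) : ℝ)| := abs_nonneg _
  calc |Real.log ((B₄ + k : ℕ) : ℝ)| * |trig ((B₄ + k : ℕ) * φ)| * |((m₀ : ℝ) / ((B₄ + k : ℕ) : ℝ)) ^ s|
      ≤ |Real.log ((B₄ + k : ℕ) : ℝ)| * 1 * |((m₀ : ℝ) / ((B₄ + k : ℕ) : ℝ)) ^ s| :=
        mul_le_mul_of_nonneg_right (mul_le_mul_of_nonneg_left (htrig _) hlog) (abs_nonneg _)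
    _ = |Real.log ((B₄ + k : ℕ) : ℝ)| * |((m₀ : ℝ) / ((B₄ + k : ℕ) : ℝ)) ^ s| := by ring

/-- The far sum of `(1,2)` as a weighted list sum of `log·cos` tails. -/
theorem farSum_12_eq (hks : PrimeData a ks) {m₀ B₄ s : ℕ} (hs : 2 ≤ s) (hB₄ : 4 ≤ B₄)
    (hT : ∀ t : Fin 4, Summable fun k : ℕ ↦ tagT a t (B₄ + k) ^ 2 / ((B₄ + k : ℕ) : ℝ) ^ 2) :
    farSum a m₀ B₄ 1 2 s = -(∑ i ∈ Finset.range ks.length, (ks.getD i default).wt *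
        ∑' k : ℕ, Real.log ((B₄ + k : ℕ) : ℝ) ^ 1 * Real.cos ((B₄ + k : ℕ) * (π * (ks.getD i default).len / a))
          * ((m₀ : ℝ) / ((B₄ + k : ℕ) : ℝ)) ^ s) := by
  have hterm : ∀ k : ℕ, tagT a 1 (B₄ + k) * tagT a 2 (B₄ + k) * ((m₀ : ℝ) / ((B₄ + k : ℕ) : ℝ)) ^ s
      = -(∑ i ∈ Finset.range ks.length, (ks.getD i default).wt *
          (Real.log ((B₄ + k : ℕ) : ℝ) ^ 1 * Real.cos ((B₄ + k : ℕ) * (π * (ks.getD i default).len / a))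
            * ((m₀ : ℝ) / ((B₄ + k : ℕ) : ℝ)) ^ s)) := by
    intro k
    rw [tagT_one, tagT_two, Encl.sum_weilPrimeIndex_eq_listSum hks, Encl.list_sum_map_eq_sum_range, mul_neg, neg_mul,
      Finset.mul_sum, Finset.sum_mul]
    congr 1
    refine Finset.sum_congr rfl fun i _ ↦ ?_
    rw [PrimeLen.log_val]; ring_nf
  have hsum : ∀ i ∈ Finset.range ks.length, Summable fun k : ℕ ↦ (ks.getD i default).wt *
      (Real.log ((B₄ + k : ℕ) : ℝ) ^ 1 * Real.cos ((B₄ + k : ℕ) * (π * (ks.getD i default).len / a))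
        * ((m₀ : ℝ) / ((B₄ + k : ℕ) : ℝ)) ^ s) :=
    fun i _ ↦ (summable_log_cos_far _ hs m₀ hB₄ hT Real.cos Real.abs_cos_le_one).mul_left _
  unfold farSum
  simp_rw [hterm]
  rw [tsum_neg, Summable.tsum_finsetSum hsum]
  congr 1
  refine Finset.sum_congr rfl fun i _ ↦ ?_
  exact tsum_mul_left

/-- The far sum of `(1,3)` as a weighted list sum of `log·sin` tails. -/
theorem farSum_13_eq (hks : PrimeData a ks) {m₀ B₄ s : ℕ} (hs : 2 ≤ s) (hB₄ : 4 ≤ B₄)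
    (hT : ∀ t : Fin 4, Summable fun k : ℕ ↦ tagT a t (B₄ + k) ^ 2 / ((B₄ + k : ℕ) : ℝ) ^ 2) :
    farSum a m₀ B₄ 1 3 s = ∑ i ∈ Finset.range ks.length, (ks.getD i default).wt *
        ∑' k : ℕ, Real.log ((B₄ + k : ℕ) : ℝ) ^ 1 * Real.sin ((B₄ + k : ℕ) * (π * (ks.getD i default).len / a))
          * ((m₀ : ℝ) / ((B₄ + k : ℕ) : ℝ)) ^ s := by
  have hterm : ∀ k : ℕ, tagT a 1 (B₄ + k) * tagT a 3 (B₄ + k) * ((m₀ : ℝ) / ((B₄ + k : ℕ) : ℝ)) ^ s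
      = ∑ i ∈ Finset.range ks.length, (ks.getD i default).wt *
          (Real.log ((B₄ + k : ℕ) : ℝ) ^ 1 * Real.sin ((B₄ + k : ℕ) * (π * (ks.getD i default).len / a))
            * ((m₀ : ℝ) / ((B₄ + k : ℕ) : ℝ)) ^ s) := by
    intro k
    rw [tagT_one, tagT_three, Encl.sum_weilPrimeIndex_eq_listSum hks, Encl.list_sum_map_eq_sum_range, Finset.mul_sum,
      Finset.sum_mul]
    refine Finset.sum_congr rfl fun i _ ↦ ?_
    rw [PrimeLen.log_val]; ring_nf
  have hsum : ∀ i ∈ Finset.range ks.length, Summable fun k : ℕ ↦ (ks.getD i default).wt *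
      (Real.log ((B₄ + k : ℕ) : ℝ) ^ 1 * Real.sin ((B₄ + k : ℕ) * (π * (ks.getD i default).len / a))
        * ((m₀ : ℝ) / ((B₄ + k : ℕ) : ℝ)) ^ s) :=
    fun i _ ↦ (summable_log_cos_far _ hs m₀ hB₄ hT Real.sin Real.abs_sin_le_one).mul_left _
  unfold farSum
  simp_rw [hterm]
  rw [Summable.tsum_finsetSum hsum]
  refine Finset.sum_congr rfl fun i _ ↦ ?_
  exact tsum_mul_left

/-- ★ `far12 ∋ farSum (1,2)`. -/
theorem mem_far12 (hS : 0 < S) (hks : PrimeData a ks) (hC : ConstsValid S a ks C) {Ke ke Kl m₀ B₄ s : ℕ} {σs : List ℚ}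
    (hB₄ : 4 ≤ B₄) (hs : 2 ≤ s) (hT : ∀ t : Fin 4, Summable fun k : ℕ ↦ tagT a t (B₄ + k) ^ 2 / ((B₄ + k : ℕ) : ℝ) ^ 2)
    {L : List MI} (hL : logTrigFarList S Ke ke Kl C σs ks.length m₀ B₄ s = some L) :
    MI.mem S (farSum a m₀ B₄ 1 2 s) ((wsum S C.wts L ks.length).neg) := by
  rw [farSum_12_eq hks hs hB₄ hT]
  refine MI.mem_neg (mem_sumBox ks.length fun i hi ↦ ?_)
  exact MI.mem_mul hS (hC.wts i hi) (mem_logTrigFarList hS hC hB₄ hs hL hi).1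

/-- ★ `far13 ∋ farSum (1,3)`. -/
theorem mem_far13 (hS : 0 < S) (hks : PrimeData a ks) (hC : ConstsValid S a ks C) {Ke ke Kl m₀ B₄ s : ℕ} {σs : List ℚ}
    (hB₄ : 4 ≤ B₄) (hs : 2 ≤ s) (hT : ∀ t : Fin 4, Summable fun k : ℕ ↦ tagT a t (B₄ + k) ^ 2 / ((B₄ + k : ℕ) : ℝ) ^ 2)
    {L : List MI} (hL : logTrigFarList S Ke ke Kl C σs ks.length m₀ B₄ s = some L) :
    MI.mem S (farSum a m₀ B₄ 1 3 s) (wsum S C.wts L ks.length) := by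
  rw [farSum_13_eq hks hs hB₄ hT]
  refine mem_sumBox ks.length fun i hi ↦ ?_
  exact MI.mem_mul hS (hC.wts i hi) (mem_logTrigFarList hS hC hB₄ hs hL hi).2

end CinfHankelR

end Summit.RiemannHypothesis.RiemannHypothesis.Theorems.WeilFormatC
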